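import Mathlib

/-!
# Moment sign lemma for the quartic (neutral-leaf) landing — kernel #107 (solo-blind, s59)

In the outer free-boundary problem of the steady thin-box model (paper §24.57(2)) the pattern
intensity on the live interval `[x₀, xₑ]` is `q(x) = ∫_{x₀}^{x} (x - t)² p(t) dt / 2` (cubic
lift-off at `x₀`), and a *quartic* (jump-free) landing at the neutral leaf `xₑ` asks for
`q = q' = q'' = 0` at `xₑ`, i.e. for the three moment conditions
`M_k := ∫_{x₀}^{xₑ} (xₑ - t)^k p(t) dt = 0`, `k = 0, 1, 2`.

This file proves the elementary obstruction behind the design dichotomy of §24.57/§24.59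
(kernel #105 was its similarity-class instance, kernel #106 the exact two-hump model):

* `moments_ne_zero_of_certificate` — a *dual certificate*: if some quadratic
  `Q(t) = γ₀ + γ₁ (xₑ - t) + γ₂ (xₑ - t)²` satisfies `p·Q ≥ 0` on `[x₀, xₑ]` with `p·Q > 0`
  somewhere in the interior, then `γ₀ M₀ + γ₁ M₁ + γ₂ M₂ > 0`, so `(M₀, M₁, M₂) ≠ 0`;
* `moments_ne_zero_of_atMostTwoSignChanges` — if `p` is continuous on `[x₀, xₑ]`, has at
  most two sign changes there (sign pattern `s, -s, s` on consecutive sub-intervals, degenerate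
  pieces allowed) and does not vanish identically on the open interval, then
  `(M₀, M₁, M₂) ≠ 0`: a quartic landing needs at least three sign changes of `p = q‴`
  (for the growth-rate reading `p ∝ -W a`: at least two separated live humps, or a hump with a
  saturated / sign-reversed core — the designed dimple of §24.59);
* `one_hump_no_quartic_landing` — the one-sign-change case already violates `(M₀, M₁) = 0`.

Only `Mathlib` is used; no `sorry`.
-/

namespace Summit.AnomalousDissipation.AnomalousDissipation.Theorems

open MeasureTheory Set intervalIntegral

/-- The `k`-th landing moment of the profile `p` on `[x₀, xₑ]`. -/
noncomputable def landingMoment (p : ℝ → ℝ) (x₀ xₑ : ℝ) (k : ℕ) : ℝ :=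
  ∫ t in x₀..xₑ, (xₑ - t) ^ k * p t

/-- A continuous function on `[a, b]` which is nonnegative there and positive at one interior
point has positive integral. -/
theorem intervalIntegral_pos_of_nonneg_of_exists_pos {f : ℝ → ℝ} {a b : ℝ}
    (hf : ContinuousOn f (Icc a b)) (h0 : ∀ t ∈ Icc a b, 0 ≤ f t)
    (hpos : ∃ c ∈ Ioo a b, 0 < f c) : 0 < ∫ t in a..b, f t := by
  obtain ⟨c, ⟨hac, hcb⟩, hc⟩ := hpos
  have hab : a < b := hac.trans hcb
  -- continuity at the interior point `c`
  have hca : ContinuousAt f c := hf.continuousAt (Icc_mem_nhds hac hcb)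
  have hev : ∀ᶠ y in nhds c, 0 < f y := continuousAt_const.eventually_lt hca hc
  obtain ⟨ε, hε, hball⟩ := Metric.eventually_nhds_iff.mp hev
  -- a small interval around `c` inside `(a, b)` on which `f > 0`
  set δ : ℝ := min (ε / 2) (min ((c - a) / 2) ((b - c) / 2)) with hδ
  have hδpos : 0 < δ := by
    rw [hδ]; refine lt_min (by linarith) (lt_min (by linarith) (by linarith))
  have hδε : δ ≤ ε / 2 := min_le_left _ _
  have hδa : δ ≤ (c - a) / 2 := (min_le_right _ _).trans (min_le_left _ _)
  have hδb : δ ≤ (b - c) / 2 := (min_le_right _ _).trans (min_le_right _ _)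
  have h1 : a ≤ c - δ := by linarith
  have h2 : c + δ ≤ b := by linarith
  have hsub : Icc (c - δ) (c + δ) ⊆ Icc a b := Icc_subset_Icc h1 h2
  have hposI : ∀ t ∈ Icc (c - δ) (c + δ), 0 < f t := by
    intro t ht
    apply hball
    rw [Real.dist_eq, abs_lt]
    constructor <;> linarith [ht.1, ht.2]
  -- the integral over the small interval is positive …
  have hint_small : IntervalIntegrable f volume (c - δ) (c + δ) :=
    (hf.mono hsub).intervalIntegrable_of_Icc (by linarith)
  have hsmall : 0 < ∫ t in (c - δ)..(c + δ), f t :=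
    intervalIntegral_pos_of_pos_on hint_small
      (fun t ht => hposI t (Ioo_subset_Icc_self ht)) (by linarith)
  -- … and dominated by the full integral since `f ≥ 0`
  have hint : IntervalIntegrable f volume a b := hf.intervalIntegrable_of_Icc hab.le
  have hmono : ∫ t in (c - δ)..(c + δ), f t ≤ ∫ t in a..b, f t := by
    refine integral_mono_interval h1 (by linarith) h2 ?_ hint
    refine ae_restrict_of_forall_mem measurableSet_Ioc ?_
    intro t ht
    have h0t : 0 ≤ f t := h0 t (Ioc_subset_Icc_self ht)
    simpa using h0t
  exact hsmall.trans_le hmono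

/-- **Dual certificate.** If a quadratic `Q(t) = γ₀ + γ₁ (xₑ - t) + γ₂ (xₑ - t)²` makes `p·Q`
nonnegative on `[x₀, xₑ]` and positive at an interior point, then
`γ₀ M₀ + γ₁ M₁ + γ₂ M₂ > 0`. -/
theorem certificate_pos {p : ℝ → ℝ} {x₀ xₑ : ℝ} (hp : ContinuousOn p (Icc x₀ xₑ))
    (γ₀ γ₁ γ₂ : ℝ)
    (hnn : ∀ t ∈ Icc x₀ xₑ, 0 ≤ p t * (γ₀ + γ₁ * (xₑ - t) + γ₂ * (xₑ - t) ^ 2))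
    (hpos : ∃ c ∈ Ioo x₀ xₑ, 0 < p c * (γ₀ + γ₁ * (xₑ - c) + γ₂ * (xₑ - c) ^ 2)) :
    0 < γ₀ * landingMoment p x₀ xₑ 0 + γ₁ * landingMoment p x₀ xₑ 1
        + γ₂ * landingMoment p x₀ xₑ 2 := by
  have hlt : x₀ < xₑ := by
    obtain ⟨c, hcI, _⟩ := hpos
    exact hcI.1.trans hcI.2
  -- continuity / integrability of the pieces
  have hk : ∀ k : ℕ, ContinuousOn (fun t => (xₑ - t) ^ k * p t) (Icc x₀ xₑ) := fun k =>
    ((continuousOn_const.sub continuousOn_id).pow k).mul hp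
  have hik : ∀ k : ℕ, IntervalIntegrable (fun t => (xₑ - t) ^ k * p t) volume x₀ xₑ :=
    fun k => (hk k).intervalIntegrable_of_Icc hlt.le
  have hQ : ContinuousOn (fun t => p t * (γ₀ + γ₁ * (xₑ - t) + γ₂ * (xₑ - t) ^ 2))
      (Icc x₀ xₑ) := by
    refine hp.mul ?_
    exact Continuous.continuousOn (by fun_prop)
  have hI := intervalIntegral_pos_of_nonneg_of_exists_pos hQ hnn hpos
  -- expand `∫ p·Q` into the three moments
  have hsum : ∫ t in x₀..xₑ, p t * (γ₀ + γ₁ * (xₑ - t) + γ₂ * (xₑ - t) ^ 2)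
      = γ₀ * landingMoment p x₀ xₑ 0 + γ₁ * landingMoment p x₀ xₑ 1
        + γ₂ * landingMoment p x₀ xₑ 2 := by
    unfold landingMoment
    rw [← intervalIntegral.integral_const_mul, ← intervalIntegral.integral_const_mul,
      ← intervalIntegral.integral_const_mul, ← intervalIntegral.integral_add ?_ ?_,
      ← intervalIntegral.integral_add ?_ ?_]
    · refine intervalIntegral.integral_congr fun t _ => ?_
      ring
    all_goals first
      | exact ((hik _).const_mul _)
      | exact (((hik _).const_mul _).add ((hik _).const_mul _))
  rw [← hsum]
  exact hI

/-- Consequence of the certificate: the moment vector is not zero. -/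
theorem moments_ne_zero_of_certificate {p : ℝ → ℝ} {x₀ xₑ : ℝ}
    (hp : ContinuousOn p (Icc x₀ xₑ)) (γ₀ γ₁ γ₂ : ℝ)
    (hnn : ∀ t ∈ Icc x₀ xₑ, 0 ≤ p t * (γ₀ + γ₁ * (xₑ - t) + γ₂ * (xₑ - t) ^ 2))
    (hpos : ∃ c ∈ Ioo x₀ xₑ, 0 < p c * (γ₀ + γ₁ * (xₑ - c) + γ₂ * (xₑ - c) ^ 2)) :
    ¬ (landingMoment p x₀ xₑ 0 = 0 ∧ landingMoment p x₀ xₑ 1 = 0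
        ∧ landingMoment p x₀ xₑ 2 = 0) := by
  rintro ⟨h0, h1, h2⟩
  have := certificate_pos hp γ₀ γ₁ γ₂ hnn hpos
  rw [h0, h1, h2] at this
  simp at this

/-- If `p` is continuous on `[x₀, xₑ]` and nonzero at some interior point, then it is nonzero at
an interior point avoiding any two prescribed points. -/
theorem exists_ne_zero_avoiding {p : ℝ → ℝ} {x₀ xₑ : ℝ} (hp : ContinuousOn p (Icc x₀ xₑ))
    (h : ∃ c ∈ Ioo x₀ xₑ, p c ≠ 0) (u v : ℝ) :
    ∃ c ∈ Ioo x₀ xₑ, c ≠ u ∧ c ≠ v ∧ p c ≠ 0 := by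
  obtain ⟨c, ⟨h1, h2⟩, hc⟩ := h
  have hca : ContinuousAt p c := hp.continuousAt (Icc_mem_nhds h1 h2)
  have hev : ∀ᶠ y in nhds c, p y ≠ 0 := hca.eventually_ne hc
  have hIoo : ∀ᶠ y in nhds c, y ∈ Ioo x₀ xₑ := Ioo_mem_nhds h1 h2
  -- pass to the punctured filter, which is `NeBot` on `ℝ` and avoids any given point
  have hev' : ∀ᶠ y in nhdsWithin c {c}ᶜ, p y ≠ 0 ∧ y ∈ Ioo x₀ xₑ :=
    (hev.and hIoo).filter_mono nhdsWithin_le_nhds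
  have hne : ∀ w : ℝ, ∀ᶠ y in nhdsWithin c {c}ᶜ, y ≠ w := by
    intro w
    by_cases hcw : c = w
    · subst hcw
      exact eventually_mem_nhdsWithin.mono fun y hy => by simpa using hy
    · exact ((continuousAt_id.eventually_ne hcw).filter_mono nhdsWithin_le_nhds).mono
        fun y hy => by simpa using hy
  obtain ⟨y, ⟨hy0, hyI⟩, hyu, hyv⟩ := (hev'.and ((hne u).and (hne v))).exists
  exact ⟨y, hyI, hyu, hyv, hy0⟩

/-- **Moment sign lemma (§24.57(2)).** `p` has *at most two sign changes* on `[x₀, xₑ]` when,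
for a sign `s = ±1` and break points `xᵤ ≤ xᵥ`, `s·p ≥ 0` on `[x₀, xᵤ]`, `s·p ≤ 0` on `[xᵤ, xᵥ]`
and `s·p ≥ 0` on `[xᵥ, xₑ]` (degenerate pieces allowed, so zero or one sign change is included).
Such a profile, if it does not vanish identically in the interior, cannot satisfy the three
quartic-landing moment conditions: a quartic landing needs at least three sign changes. -/
theorem moments_ne_zero_of_atMostTwoSignChanges {p : ℝ → ℝ} {x₀ xₑ : ℝ}
    (hp : ContinuousOn p (Icc x₀ xₑ)) {s xᵤ xᵥ : ℝ} (hs : s = 1 ∨ s = -1) (huv : xᵤ ≤ xᵥ)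
    (hA : ∀ t ∈ Icc x₀ xᵤ, 0 ≤ s * p t) (hB : ∀ t ∈ Icc xᵤ xᵥ, s * p t ≤ 0)
    (hC : ∀ t ∈ Icc xᵥ xₑ, 0 ≤ s * p t) (hnz : ∃ c ∈ Ioo x₀ xₑ, p c ≠ 0) :
    ¬ (landingMoment p x₀ xₑ 0 = 0 ∧ landingMoment p x₀ xₑ 1 = 0
        ∧ landingMoment p x₀ xₑ 2 = 0) := by
  -- certificate `Q(t) = s (t - xᵤ)(t - xᵥ)` written in the basis `(xₑ - t)^k`
  refine moments_ne_zero_of_certificate hp (s * ((xₑ - xᵤ) * (xₑ - xᵥ)))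
    (-(s * (2 * xₑ - xᵤ - xᵥ))) s ?_ ?_
  · intro t ht
    have hQ : s * ((xₑ - xᵤ) * (xₑ - xᵥ)) + -(s * (2 * xₑ - xᵤ - xᵥ)) * (xₑ - t)
        + s * (xₑ - t) ^ 2 = s * ((t - xᵤ) * (t - xᵥ)) := by ring
    rw [hQ]
    have key : p t * (s * ((t - xᵤ) * (t - xᵥ))) = (s * p t) * ((t - xᵤ) * (t - xᵥ)) := by
      ring
    rw [key]
    rcases le_total t xᵤ with htu | htu
    · -- first piece: `s p ≥ 0`, `(t - xᵤ)(t - xᵥ) ≥ 0`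
      have h1 : 0 ≤ s * p t := hA t ⟨ht.1, htu⟩
      have h2 : 0 ≤ (t - xᵤ) * (t - xᵥ) :=
        mul_nonneg_of_nonpos_of_nonpos (by linarith) (by linarith)
      exact mul_nonneg h1 h2
    · rcases le_total t xᵥ with htv | htv
      · -- middle piece: `s p ≤ 0`, product `≤ 0`
        have h1 : s * p t ≤ 0 := hB t ⟨htu, htv⟩
        have h2 : (t - xᵤ) * (t - xᵥ) ≤ 0 :=
          mul_nonpos_iff.mpr (Or.inl ⟨by linarith, by linarith⟩)
        exact mul_nonneg_of_nonpos_of_nonpos h1 h2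
      · -- last piece
        have h1 : 0 ≤ s * p t := hC t ⟨htv, ht.2⟩
        have h2 : 0 ≤ (t - xᵤ) * (t - xᵥ) := mul_nonneg (by linarith) (by linarith)
        exact mul_nonneg h1 h2
  · obtain ⟨c, hcI, hcu, hcv, hc⟩ := exists_ne_zero_avoiding hp hnz xᵤ xᵥ
    refine ⟨c, hcI, ?_⟩
    have hQ : s * ((xₑ - xᵤ) * (xₑ - xᵥ)) + -(s * (2 * xₑ - xᵤ - xᵥ)) * (xₑ - c)
        + s * (xₑ - c) ^ 2 = s * ((c - xᵤ) * (c - xᵥ)) := by ring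
    rw [hQ]
    have key : p c * (s * ((c - xᵤ) * (c - xᵥ))) = (s * p c) * ((c - xᵤ) * (c - xᵥ)) := by
      ring
    rw [key]
    have hsp : s * p c ≠ 0 := by
      rcases hs with rfl | rfl <;> simpa using hc
    have hcI' : c ∈ Icc x₀ xₑ := Ioo_subset_Icc_self hcI
    rcases lt_trichotomy c xᵤ with hlu | heq | hgu
    · have h1 : 0 < s * p c := lt_of_le_of_ne (hA c ⟨hcI'.1, hlu.le⟩) hsp.symm
      have h2 : 0 < (c - xᵤ) * (c - xᵥ) := mul_pos_of_neg_of_neg (by linarith) (by linarith)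
      exact mul_pos h1 h2
    · exact absurd heq hcu
    · rcases lt_trichotomy c xᵥ with hlv | heq' | hgv
      · have h1 : s * p c < 0 := lt_of_le_of_ne (hB c ⟨hgu.le, hlv.le⟩) hsp
        have h2 : (c - xᵤ) * (c - xᵥ) < 0 := mul_neg_of_pos_of_neg (by linarith) (by linarith)
        exact mul_pos_of_neg_of_neg h1 h2
      · exact absurd heq' hcv
      · have h1 : 0 < s * p c := lt_of_le_of_ne (hC c ⟨hgv.le, hcI'.2⟩) hsp.symm
        have h2 : 0 < (c - xᵤ) * (c - xᵥ) := mul_pos (by linarith) (by linarith)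
        exact mul_pos h1 h2

/-- **One hump never lands quartically** (the general-profile form of kernel #105): if `p ≥ 0`
on `[x₀, xᵤ]` and `p ≤ 0` on `[xᵤ, xₑ]` (one sign change, as for a one-hump growth profile read
through `q''' = p`) and `p` is not identically zero in the interior, then already
`(M₀, M₁) ≠ 0`; indeed `M₁ - (xₑ - xᵤ) M₀ > 0`. -/
theorem one_hump_no_quartic_landing {p : ℝ → ℝ} {x₀ xᵤ xₑ : ℝ}
    (hp : ContinuousOn p (Icc x₀ xₑ))
    (hA : ∀ t ∈ Icc x₀ xᵤ, 0 ≤ p t) (hB : ∀ t ∈ Icc xᵤ xₑ, p t ≤ 0)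
    (hnz : ∃ c ∈ Ioo x₀ xₑ, p c ≠ 0) :
    0 < landingMoment p x₀ xₑ 1 - (xₑ - xᵤ) * landingMoment p x₀ xₑ 0 := by
  -- certificate `Q(t) = (xᵤ - t) = (xₑ - t) - (xₑ - xᵤ)`, `γ₂ = 0`
  have hnn : ∀ t ∈ Icc x₀ xₑ,
      0 ≤ p t * (-(xₑ - xᵤ) + 1 * (xₑ - t) + 0 * (xₑ - t) ^ 2) := by
    intro t ht
    have hQ : -(xₑ - xᵤ) + 1 * (xₑ - t) + 0 * (xₑ - t) ^ 2 = xᵤ - t := by ring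
    rw [hQ]
    rcases le_total t xᵤ with htu | htu
    · exact mul_nonneg (hA t ⟨ht.1, htu⟩) (by linarith)
    · exact mul_nonneg_of_nonpos_of_nonpos (hB t ⟨htu, ht.2⟩) (by linarith)
  have hpos : ∃ c ∈ Ioo x₀ xₑ,
      0 < p c * (-(xₑ - xᵤ) + 1 * (xₑ - c) + 0 * (xₑ - c) ^ 2) := by
    obtain ⟨c, hcI, hcu, -, hc⟩ := exists_ne_zero_avoiding hp hnz xᵤ xᵤ
    refine ⟨c, hcI, ?_⟩
    have hQ : -(xₑ - xᵤ) + 1 * (xₑ - c) + 0 * (xₑ - c) ^ 2 = xᵤ - c := by ring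
    rw [hQ]
    have hcI' : c ∈ Icc x₀ xₑ := Ioo_subset_Icc_self hcI
    rcases lt_trichotomy c xᵤ with hlu | heq | hgu
    · exact mul_pos (lt_of_le_of_ne (hA c ⟨hcI'.1, hlu.le⟩) (Ne.symm hc)) (by linarith)
    · exact absurd heq hcu
    · exact mul_pos_of_neg_of_neg (lt_of_le_of_ne (hB c ⟨hgu.le, hcI'.2⟩) hc) (by linarith)
  have h := certificate_pos hp (-(xₑ - xᵤ)) 1 0 hnn hpos
  have hrw : landingMoment p x₀ xₑ 1 - (xₑ - xᵤ) * landingMoment p x₀ xₑ 0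
      = -(xₑ - xᵤ) * landingMoment p x₀ xₑ 0 + 1 * landingMoment p x₀ xₑ 1
        + 0 * landingMoment p x₀ xₑ 2 := by ring
  rw [hrw]
  exact h

/-- In particular a one-hump profile violates the quartic-landing conditions. -/
theorem one_hump_moments_ne_zero {p : ℝ → ℝ} {x₀ xᵤ xₑ : ℝ}
    (hp : ContinuousOn p (Icc x₀ xₑ))
    (hA : ∀ t ∈ Icc x₀ xᵤ, 0 ≤ p t) (hB : ∀ t ∈ Icc xᵤ xₑ, p t ≤ 0)
    (hnz : ∃ c ∈ Ioo x₀ xₑ, p c ≠ 0) :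
    ¬ (landingMoment p x₀ xₑ 0 = 0 ∧ landingMoment p x₀ xₑ 1 = 0) := by
  rintro ⟨h0, h1⟩
  have h := one_hump_no_quartic_landing hp hA hB hnz
  rw [h0, h1] at h
  simp at h

end Summit.AnomalousDissipation.AnomalousDissipation.Theorems
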